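import Literature.NumberTheory.EllipticCurves.LiLiuTian2024.CongruentNumberFullBSD
import Literature.NumberTheory.EllipticCurves.BSDAverageRankFiveSelmer
import Literature.NumberTheory.EllipticCurves.TwoDescentLinearConditions
import Literature.NumberTheory.EllipticCurves.MordellWeilModNCard
import Literature.NumberTheory.EllipticCurves.TwoTorsionCardProofs
import HarnessLib

/-!
# Smith 2016, *The congruent numbers have positive natural density*, Cor. 1.3 AS PRINTED — the FULL Birch–Swinnerton-Dyer conjecture (every prime, in particular `p = 2`) for the congruent number curve `E^{(n)} : y² = x³ − n²x` whenever its `2`-Selmer group has rank two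

HONEST FRAMING (cell `b2b-bsdres`, sub-lane `bsd-p2`, run/shared/lean/b2b/bsd-rank1-residual/p2/;
literature typer 1, mandate (iv)): ONE statement from a proving source, vendored as a named `Prop`
(nothing asserted, nothing discharged; D-0014), every printed hypothesis a binder, locators into the
held text; plus bookkeeping PROVED from tree theorems. SOURCE TIER: an arXiv PREPRINT (v2,
29 Mar 2016, 32 pp.; no journal version located on arXiv / Crossref as of 2026-08-22) — cited as a
result by Tian, Proc. ICM 2022 [Tian2023CongruentICM] (Thm. 8, Thm. 15: "(Smith)") and by
S. Zhang, J. Algebra (2026) = galaxy-pdf-4729444520 §1 ("the full BSD conjecture holds, see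
[TYZ17] and [Smi16]"); the registry tiers it. EVIDENCE of what print says `2`-adically for ONE
quadratic-twist family (the congruent number curves, CM by `ℤ[i]`, ANALYTIC RANK ZERO); nothing
booked; no mark moved.

Source. A. Smith, *The congruent numbers have positive natural density*, arXiv:1603.08479 (2016)
[Smith2016CongruentDensity]. Text read: the held LaTeX-derived text `paper:arxiv-1603.08479`
(18 chunks `p0001`–`p0018`, no PDF pagination; locators are `chunk:line`).

## The printed statements (verbatim, §1 = chunk p0003)

* (p0003 L3–L7) "Suppose `E/ℚ` is a rank zero elliptic curve of conductor `N` … One consequence of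
  the full Birch and Swinnerton-Dyer (BSD) conjecture would be that
  `L(1,E) · (#E_tors)² / (Ω(E) ∏_{p ∣ 2N} c_p(E)) = |Ш(E)|` where the `c_p` are Tamagawa factors and
  `Ω(E)` is the least positive real period of `E`. Calling the expression on the left `ℒ(E)` …"
* **Conjecture 1.1** (p0003 L9–L13): "If `E/ℚ` is an elliptic curve without rational four torsion,
  then `ℒ(E)` is an odd integer if and only if the `2`-Selmer group `Sel^{(2)}(E)` is generated by
  the image of `E(ℚ)[2] ⊆ E(ℚ)` in the exact sequence `0 → E(ℚ)/2E(ℚ) → Sel^{(2)}(E) → Ш(E)[2] → 0`."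
* (p0003 L17–L21) "For the rest of the paper, take `E` to be the congruent number curve, and for
  any positive squarefree integer `n` take `E^{(n)}` to be the quadratic twist of `E` given by
  Weierstrass equation `y² = x³ − n²x`."
* **Theorem 1.2** (p0003 L29–L31): "Conjecture 1.1 is true for all quadratic twists of the
  congruent number curve."
* (p0003 L33–L37) "Now, `E^{(n)}` is a CM elliptic curve with CM field `ℚ(i)`, so we can use Rubin's
  proof of the main conjecture of Iwasawa theory for imaginary quadratic fields [Rubi91] to say
  `v_p(ℒ(E^{(n)}) / |Ш(E^{(n)})|) = 0` for any `E^{(n)}` of analytic rank `0` and any odd prime `p`.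
  Waldspurger's formula implies that `ℒ(E^{(n)})` is nonnegative, so we get the following lovely
  corollary to Theorem 1.2."
* **Corollary 1.3** (p0003 L39–L44): "The elliptic curve `E^{(n)} : y² = x³ − n²x` satisfies the
  full BSD conjecture if `Sel^{(2)}(E^{(n)})` is generated by `2`-torsion, or rather has rank two. In
  particular, given `t ∈ {1, 2, 3}`, `E^{(n)}` satisfies full BSD for at least 41.9% of squarefree
  positive `n ≡ t (8)`." (p0003 L46: "The percentage in this result comes from Heath-Brown's
  computation of the proportion of `E^{(n)}` with specified `2`-Selmer rank in [Heat94].")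
* Proof architecture (chunk p0005 L50–L72): Thm. 2.1 = Tian–Yuan–Zhang [Tian14] (tree:
  `TianYuanZhang2017.thm11_parity_of_scriptL`): for `n ≡ x (8)`, `x ∈ {1,2,3}`,
  `ℒ(E^{(n)}) ≡ ℒ_x(n) (mod 2)`; Thm. 2.2: `ℒ_x(n) = det M_x` for the matrices of Table 1; Monsky
  [Heat94]: `rk Sel^{(2)}(E^{(n)}) = 2 + crnk(M_x)` (`x = 1, 2`), `= 1 + crnk(M_3[[2r],[2r]])`
  (`x = 3`); "With Theorem 2.2 and Theorem 2.1, we immediately get the theorem for `n ≡ 1, 2 (8)`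
  …" For `n ≡ 5, 6, 7 (8)` the root number is `−1` (`L(E^{(n)},1) = 0`, `ℒ = 0` even) and the
  `2`-Selmer rank is odd `≥ 3` (Monsky), so both sides of Conjecture 1.1 fail.

## What is typed, and the `p = 2` flag

ONLY Corollary 1.3, first sentence (`cor13_bsd_of_selmerRankTwo`): hypothesis "`Sel^{(2)}(E^{(n)})`
has rank two" ⟹ "the full BSD conjecture" for `E^{(n)}`. It is a statement at EVERY prime — in
particular the `2`-PART of the BSD formula (and the `p`-part at the additive primes `p ∣ 2n`) — for
an explicit, decidable (Monsky's matrix) infinite sub-family of the RANK-ZERO congruent number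
curves: the twin at analytic rank `0` of Li–Liu–Tian 2024 Thm. 1.2 (tree:
`LiLiuTian2024.thm12_bsd_congruentNumberCurve`, analytic rank `1`). No prime is excluded and no
"`p` odd" occurs: ALLOWS-2 (indeed ABOUT 2: the hypothesis is a `2`-descent condition). Under the
hypothesis the curve has Mordell–Weil rank `0` — PROVED below from the tree's descent inequality
`2^{rank} · #E(ℚ)[2] ≤ #Sel^{(2)}` and `#E^{(n)}(ℚ)[2] = 4` — so the pairs it bears on are the
census's `r = 0` congruent-number classes (`N = 32n²` for odd `n`, `N = 16n²`-type for even `n`)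
with `s(n) := dim Sel^{(2)}(E^{(n)}) − 2 = 0`; by Thm. 1.2 these are exactly the `n ≡ 1, 2, 3 (8)`
with `#Ш_an(E^{(n)})` odd. The density clause ("at least 41.9%", Heath-Brown) is NOT typed
(a natural-density statement; support only).

NOT typed — ROW ONLY, with a PRINT-NORMALISATION FLAG: Theorem 1.2 / Conjecture 1.1. The printed
`ℒ(E)` divides by "the least positive real period" `Ω(E)`. Every `E^{(n)}` has
`Δ = 64n⁶ > 0`, two real components, and BSD period `∫_{E(ℝ)}|ω| = 2 ×` (least positive real
period); Thm. 2.1 imports `ℒ(E^{(n)}) (mod 2)` from Tian–Yuan–Zhang, whose normalisation (1.1)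
`#Ш(E_n) = 𝓛(n)²` IS the BSD formula (checked numerically by this lineage, kit `j142692`, see the
TYZ file). With the LITERAL least-period reading, `ℒ(E^{(1)}) = 16 · L(E^{(1)},1)/(ω₁ · c₂) = 2`
(`32a2`: `L(E,1) = Ω_BSD/8`, `ω₁ = Ω_BSD/2 = Γ(¼)²/(2√(2π))`, `c₂ = 2`, `#E(ℚ)_tors = 4`) would be
EVEN although `Sel^{(2)}(E^{(1)}) = E[2]` has rank two — so the theorem that is PROVED (and meant) is
the one with `Ω(E) = ∫_{E(ℝ)}|ω|`, i.e. `ℒ(E^{(n)}) = #Ш_an(E^{(n)})`. Kit job `j148685` (this seat,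
PARI 2.15, 2 s; stdout sha16 `ad64befe1002b03c`) tabulates both readings against the pure
`2`-Selmer rank `s(n) = R + s` of `ellrank` for all 183 squarefree `n ≤ 300`: on the 89 of them with
`n ≡ 1, 2, 3 (8)`, "`#Ш_an(E^{(n)})` odd ⟺ `s(n) = 0`" holds 89/89 (values `#Ш_an ∈ {1, 9}` at
`s(n) = 0`, e.g. `n = 43, 107, 131` give `9`; `#Ш_an ∈ {4, 16, …}` or `L = 0` at `s(n) ≥ 2`,
e.g. `n = 17`: `#Ш_an = 4`, `s = 2`), while the literal least-period value `2·#Ш_an` is odd 0/89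
times. A typed Thm. 1.2 would therefore have to CHOOSE a normalisation; it is left as a row until a
consumer names it (its census content beyond Cor. 1.3 is one-sided: `s(n) ≥ 2`, `n ≡ 1,2,3 (8)` ⟹
`#Ш_an(E^{(n)})` even or `L(E^{(n)},1) = 0`). Corollary 1.3 itself contains no period and is typed
verbatim.

## Transcription (tree dictionary)

* `E^{(n)} : y² = x³ − n²x`, `n` positive squarefree: the tree's `congruentNumberCurve n = ⟨0,0,0,−n²,0⟩`
  with `Squarefree n` (`n : ℕ`, so `n ≥ 1`); it is elliptic and a global minimal model
  (`isElliptic_congruentNumberCurve`, `isGloballyMinimal_congruentNumberCurve`), supplied as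
  instance binders exactly as in `LiLiuTian2024.thm12_bsd_congruentNumberCurve`.
* "`Sel^{(2)}(E^{(n)})` … has rank two": the tree's `2`-Selmer group
  `WeierstrassCurve.selmerGroup W 2 ⊆ H¹(ℚ, E[2])` (`Selmer.lean`; an elementary abelian `2`-group)
  has `Nat.card = 4 = 2²`. ("generated by `2`-torsion, or rather has rank two": the image of
  `E^{(n)}(ℚ)[2] ≅ (ℤ/2)²` under the Kummer map is a rank-two subgroup, so the two printed phrasings
  agree; we type the author's preferred one, "rank two".)
* "satisfies the full BSD conjecture": the tree's `WeierstrassCurve.BSDTriple`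
  (`analyticRank = mordellWeilRank ∧ ShaFinite ∧ leadingLCoeff = bsdRHS`, `BSDInvariants.lean`), the
  same rendering as `LiLiuTian2024.thm12_bsd_congruentNumberCurve`; its every-prime corollary
  `BSDp W ℓ` (Miller's `BSD(E, ℓ)`) is derived below by the tree's `forall_bsdp_of_bsdTriple'`.
No `_holds` expected (Waldspurger + Tian–Yuan–Zhang genus-period induction + Smith's determinant
identities + Monsky + Rubin's main conjecture). Consumers take `(h : cor13_bsd_of_selmerRankTwo)`.

## References
* [Smith2016CongruentDensity] A. Smith, arXiv:1603.08479 (2016): §1 Conj. 1.1, Thm. 1.2, Cor. 1.3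
  (chunk p0003 L3–L46); §2 Thm. 2.1, Thm. 2.2, proof of Thm. 1.2 (chunk p0005 L48–L72).
* [TianYuanZhang2017] Asian J. Math. 21 (2017) 721–774, Thm. 1.1 (= Smith's Thm. 2.1).
* [Tian2023CongruentICM] Y. Tian, Proc. ICM 2022, Thm. 8 and Thm. 15 (attributions to Smith).
* [SilvermanAEC2009] Thm. X.4.2 (descent sequence), Cor. III.6.4 (`#E[2] ≤ 4`).
* Kit jobs `j142692` (GEN 1, TYZ normalisation) and `j148685` (this seat, Smith normalisation).
-/

noncomputable section

open scoped Classical AddSubgroup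

open WeierstrassCurve Literature.NumberTheory.EllipticCurves

namespace Literature.NumberTheory.EllipticCurves.Smith2016

/-! ### §1. The named fact: Smith 2016, Corollary 1.3 (first sentence) -/

/-- **Smith 2016, Corollary 1.3** (verbatim in the module docstring; here the bracket `[full BSD]`
stands for the author's three words naming the Birch–Swinnerton-Dyer statement in full): "The
elliptic curve `E^{(n)} : y² = x³ − n²x` satisfies the [full BSD] if `Sel^{(2)}(E^{(n)})` is
generated by `2`-torsion, or rather has rank two." A THEOREM of the source (proved there from
Thm. 1.2, Rubin 1991 and Waldspurger), vendored as a named fact: for every positive squarefree `n`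
(the paper's standing convention, p0003 L17–L21) such that the `2`-Selmer group of
`congruentNumberCurve n` over `ℚ` has exactly `4 = 2²` elements, RANK ∧ SHAFIN ∧ LEAD
(`WeierstrassCurve.BSDTriple`) hold for `congruentNumberCurve n`. A statement at every prime, in
particular the `2`-part of the BSD formula, for a rank-zero CM family; arXiv preprint (tier: the
registry's). No `_holds` expected.
[cite: Smith2016CongruentDensity, Cor. 1.3 (arXiv:1603.08479 chunk p0003 L39–L44); Thm. 1.2 (L29–L31) with Rubin 1991 (L33–L37)] -/
def cor13_bsd_of_selmerRankTwo : Prop :=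
  ∀ (n : ℕ) [(congruentNumberCurve n).IsElliptic] [(congruentNumberCurve n).IsGloballyMinimal],
    Squarefree n → Nat.card ((congruentNumberCurve n).selmerGroup 2) = 4 →
      (congruentNumberCurve n).BSDTriple

/-! ### §2. Bookkeeping PROVED from tree theorems: the hypothesis pins Mordell–Weil rank `0` -/

/-- `#E^{(n)}(ℚ)[2] = 4` for `n ≠ 0`: the three rational roots `−n, 0, n` of `x³ − n²x` give four
`2`-torsion points (tree: `four_le_natCard_torsionBy_two_of_splitTwoTorsion` with
`TwoDescentLocal.splitTwoTorsion_cn`), and an elliptic curve over a field with `2 ≠ 0` has at most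
four (tree: `WeierstrassCurve.natCard_torsionBy_two_le`). [cite: SilvermanAEC2009, Cor. III.6.4(b)] -/
theorem natCard_torsionBy_two_congruentNumberCurve {n : ℕ} (hn : n ≠ 0) :
    haveI := isElliptic_congruentNumberCurve hn
    Nat.card ((congruentNumberCurve n).toAffine.Point[(2 : ℤ)]) = 4 := by
  haveI := isElliptic_congruentNumberCurve hn
  -- upper bound: the generic tree lemma is stated with the classical `DecidableEq` on the base
  -- field; `convert` bridges it to `ℚ`'s own instance (`DecidableEq` is a subsingleton)
  have hle : Nat.card ((congruentNumberCurve n).toAffine.Point[(2 : ℤ)]) ≤ 4 := by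
    convert (congruentNumberCurve n).natCard_torsionBy_two_le two_ne_zero
  -- finiteness of `E(ℚ)[2]` (Mordell–Weil, tree theorem), then the lower bound from `−n, 0, n`
  haveI : Module.Finite ℤ (congruentNumberCurve n).toAffine.Point := by
    convert (congruentNumberCurve n).module_finite_point_holds
  haveI : Finite ((congruentNumberCurve n).toAffine.Point[((2 : ℕ) : ℤ)]) :=
    finite_torsionBy_of_moduleFinite _ 2
  have hge : 4 ≤ Nat.card ((congruentNumberCurve n).toAffine.Point[((2 : ℕ) : ℤ)]) :=
    four_le_natCard_torsionBy_two_of_splitTwoTorsion (TwoDescentLocal.splitTwoTorsion_cn n)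
  have hge' : 4 ≤ Nat.card ((congruentNumberCurve n).toAffine.Point[(2 : ℤ)]) := by
    simpa only [Nat.cast_ofNat] using hge
  exact le_antisymm hle hge'

/-- **Under the hypothesis of Cor. 1.3 the Mordell–Weil rank is `0`** (so the statement bears on
the census's rank-zero congruent-number classes): from the tree's descent inequality
`2^{rank E(ℚ)} · #E(ℚ)[2] ≤ #Sel^{(2)}(E/ℚ)`
(`pow_mordellWeilRank_mul_card_torsionBy_le_rat`, the `ℚ`-instance form of
`WeierstrassCurve.pow_mordellWeilRank_mul_card_torsionBy_le_card_selmerGroup`, Silverman X.4.2)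
and `#E^{(n)}(ℚ)[2] = 4`. This is the content of the printed gloss "generated by `2`-torsion, or
rather has rank two". [cite: Smith2016CongruentDensity, Cor. 1.3 (chunk p0003 L44)]
[cite: SilvermanAEC2009, Thm. X.4.2] -/
theorem mordellWeilRank_eq_zero_of_card_selmerGroup_two {n : ℕ} (hn : n ≠ 0)
    (h : Nat.card ((congruentNumberCurve n).selmerGroup 2) = 4) :
    haveI := isElliptic_congruentNumberCurve hn
    (congruentNumberCurve n).mordellWeilRank = 0 := by
  haveI := isElliptic_congruentNumberCurve hn
  have hineq := pow_mordellWeilRank_mul_card_torsionBy_le_rat (congruentNumberCurve n) 2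
  have htors : Nat.card ((congruentNumberCurve n).toAffine.Point[((2 : ℕ) : ℤ)]) = 4 := by
    simpa only [Nat.cast_ofNat] using natCard_torsionBy_two_congruentNumberCurve hn
  have hsel : Nat.card ((congruentNumberCurve n).selmerGroup ((2 : ℕ) : ℤ)) = 4 := by
    simpa only [Nat.cast_ofNat] using h
  rw [htors, hsel] at hineq
  -- `2 ^ r * 4 ≤ 4 = 1 * 4` forces `2 ^ r ≤ 1`, i.e. `r = 0`
  have hpow : 2 ^ (congruentNumberCurve n).mordellWeilRank ≤ 1 :=
    Nat.le_of_mul_le_mul_right (by simpa only [one_mul] using hineq) (by norm_num)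
  by_contra hr
  exact absurd hpow (not_le.mpr (Nat.one_lt_two_pow hr))

/-! ### §3. Consequences of the named fact (instances discharged; the cell's currency) -/

/-- **Cor. 1.3, instances discharged**: for squarefree `n` (so `n ≥ 1`; the tree's elliptic and
global-minimal instances are theorems) with `#Sel^{(2)}(E^{(n)}/ℚ) = 4`, the curve `y² = x³ − n²x`
satisfies RANK ∧ SHAFIN ∧ LEAD, and its Mordell–Weil rank (hence, by RANK, its analytic rank) is `0`.
[cite: Smith2016CongruentDensity, Cor. 1.3] -/
theorem bsdTriple_congruentNumberCurve_of_cor13 (h : cor13_bsd_of_selmerRankTwo) {n : ℕ}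
    (hsq : Squarefree n) (hsel : Nat.card ((congruentNumberCurve n).selmerGroup 2) = 4) :
    haveI := isElliptic_congruentNumberCurve (Squarefree.ne_zero hsq)
    haveI := isGloballyMinimal_congruentNumberCurve hsq
    (congruentNumberCurve n).BSDTriple ∧ (congruentNumberCurve n).mordellWeilRank = 0 ∧
      (congruentNumberCurve n).analyticRank = 0 := by
  haveI := isElliptic_congruentNumberCurve (Squarefree.ne_zero hsq)
  haveI := isGloballyMinimal_congruentNumberCurve hsq
  have hB : (congruentNumberCurve n).BSDTriple := h n hsq hsel
  have hr : (congruentNumberCurve n).mordellWeilRank = 0 :=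
    mordellWeilRank_eq_zero_of_card_selmerGroup_two (Squarefree.ne_zero hsq) hsel
  refine ⟨hB, hr, ?_⟩
  have hrank := ((congruentNumberCurve n).bsdTriple_iff.mp hB).1
  rw [hrank, hr]

/-- **`BSD(E^{(n)}, ℓ)` for EVERY prime `ℓ`** (Miller's Def. 1.1; in particular `ℓ = 2`, the
sub-lane's prime, and the additive primes `ℓ ∣ 2n`) on Smith's family — from RANK ∧ SHAFIN ∧ LEAD
by the tree's hypothesis-free `forall_bsdp_of_bsdTriple'`.
[cite: Smith2016CongruentDensity, Cor. 1.3] [cite: Miller2011LMS, §1 and Def. 1.1] -/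
theorem forall_bsdp_congruentNumberCurve_of_cor13 (h : cor13_bsd_of_selmerRankTwo) {n : ℕ}
    [(congruentNumberCurve n).IsElliptic] [(congruentNumberCurve n).IsGloballyMinimal]
    (hsq : Squarefree n) (hsel : Nat.card ((congruentNumberCurve n).selmerGroup 2) = 4)
    (ℓ : ℕ) (hℓ : ℓ.Prime) :
    BSDp (congruentNumberCurve n) ℓ :=
  forall_bsdp_of_bsdTriple' _ (h n hsq hsel) ℓ hℓ

/-- **The `2`-part of BSD on Smith's family** (`ℓ = 2` in the previous theorem): the predicate of
record of the sub-lane's consumers (`BSDp W 2`). [cite: Smith2016CongruentDensity, Cor. 1.3] -/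
theorem bsdp_two_congruentNumberCurve_of_cor13 (h : cor13_bsd_of_selmerRankTwo) {n : ℕ}
    [(congruentNumberCurve n).IsElliptic] [(congruentNumberCurve n).IsGloballyMinimal]
    (hsq : Squarefree n) (hsel : Nat.card ((congruentNumberCurve n).selmerGroup 2) = 4) :
    BSDp (congruentNumberCurve n) 2 :=
  forall_bsdp_congruentNumberCurve_of_cor13 h hsq hsel 2 Nat.prime_two

end Literature.NumberTheory.EllipticCurves.Smith2016

end
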